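import Mathlib
import Summits.KontsevichZagierPeriods.Zeta5Search.Families.CellularVIMRecurrenceLaws
import Summits.KontsevichZagierPeriods.Zeta5Search.Certificates.VIML3Holds
import HarnessLib

/-!
# ζ(5) search — Families: the VIM torus period as a three-fold chain sum, and UNIQUENESS for the VIM recurrence

HONEST FRAMING: systematic search; no irrationality claim unless certified.  Cell `pub-zeta5`, family designer fam-tele g13,
2026-08-22.  Identities and recurrences of finite binomial sums; nothing about the arithmetic of `ζ(5)` or `ζ(7)`; no record moves.

OBJECTS.  For Brown's `vanishing in the middle' plan (`N = 10`, [BrownZudilin2022, §12]; tree `Cells/VanishingMiddleLeading`,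
`Families/CellularVIMRecurrenceLaws`) write the `n`-th power of the basic integrand in the gap coordinates `g₀,…,g₇` of the DUAL cell
with the dual point `τ⁻¹(9)` at infinity (`τ = (3,1,5,2,7,4,9,6,8,0)`): it is `∏_e (Σ_{w ∈ span e} g_w)ⁿ / ∏_w g_wⁿ` over the eight
finite chords `e`, spans `[0,1],[0,3],[1,3],[1,5],[3,5],[3,7],[5,7],[5,6]`.  Extracting the constant term by three binomial splits
(chords `[1,3]`, `[3,5]`, `[3,7]`; every other extraction is forced) gives the THREE-FOLD CHAIN SUM
`J(n) = Σ_u C(n,u) C(2n−u,n) · M₁(n,u) · M₂(n,u)`,  `M₁(n,u) = Σ_i C(n,i)² C(n+i,n) C(n+i,u)`,  `M₂(n,u) = Σ_v C(2n−u,v) C(n,v) C(2n−v,n)²`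
(`HOME/pub-zeta5-fam-tele/g13/README.md` §3, `families/tele/RECURRENCE.md` §17).  In THIS file `J` is simply DEFINED by that formula (`VIMTorus.J`);
the derivation 'constant term = J' and the gauge invariance of the constant term (checked exactly for `n ≤ 3` in all ten gauges; P2's
`dualCount vimSpans` is the gauge `τ⁻¹(6)` at infinity) are NOT formalised here.

KERNEL CONTENT (standard axioms):
* `VIMTorus.J_eq_A_upto_five` — `J n = A n` for `n ≤ 5` (`decide` against the tree theorems `A_zero … A_five`): D-exact(VIM) instances on the
  diagonal (outside the kernel: `J n = A n` for ALL `n ≤ 130` against fam-brown9's independently computed table, `g13/trackB/vim3fold.py`);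
* `evalList_P4_pos` — the leading coefficient `P₄(n)` of the cell's order-4 operator is `> 0` for every `n : ℕ` (all twenty coefficients are
  positive; `decide` + a Horner-scheme induction);
* **`eq_A_of_opApply_eq_zero`** — UNIQUENESS: an integer sequence annihilated by the operator (`opApply u n = 0 ∀ n`) with
  `u 0, u 1, u 2, u 3 = 1, 61, 52921, 94357501` IS `A` — by `P₄ > 0` and the KERNEL THEOREM `VIMLeadingRecurrence`
  (`Certificates/VIML3Holds`, `VIMInner.L3.vimLeadingRecurrence_holds`, cert-1/cert-2);
* `VIMTorus.dexactDiag_of_recurrence` — hence **D-exact(VIM) on the whole diagonal, `A n = J n ∀ n`, follows from the single statement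
  `∀ n, opApply J n = 0`** (typed below as the `@[conjecture]` node `VIMTorus.TorusPeriodRecurrence`; it is the target of ONE outer ∂-finite
  creative-telescoping certificate over the product of the two inner modules, whose order-3 generators in `u` and `n` are CERTIFIED outside the
  kernel by `exactrec.telescoping 0.1.5`, `g13/trackB/zeil/`).  Nothing is claimed about that node here.
-/

namespace Summit.KontsevichZagierPeriods.Zeta5Search.Families.Cellular

open CellularVIMRecurrenceLaws

/-! ## Positivity of the leading coefficient `P₄` and uniqueness for the VIM recurrence -/

/-- Horner evaluation of a list with nonnegative entries at a nonnegative point is nonnegative. -/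
theorem evalList_nonneg_of_forall_nonneg (c : List ℤ) (hc : ∀ a ∈ c, 0 ≤ a) (n : ℤ) (hn : 0 ≤ n) :
    0 ≤ evalList c n := by
  induction c with
  | nil => simp [evalList]
  | cons a t ih =>
    have ha : 0 ≤ a := hc a (by simp)
    have ht : 0 ≤ evalList t n := ih (fun b hb => hc b (by simp [hb]))
    show 0 ≤ a + n * List.foldr (fun a acc => a + n * acc) 0 t
    have : 0 ≤ n * evalList t n := mul_nonneg hn ht
    simpa [evalList] using add_nonneg ha this

/-- Horner evaluation of a NONEMPTY list with positive entries at a nonnegative point is positive. -/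
theorem evalList_pos_of_forall_pos (a : ℤ) (t : List ℤ) (ha : 0 < a) (ht : ∀ b ∈ t, 0 ≤ b) (n : ℤ) (hn : 0 ≤ n) :
    0 < evalList (a :: t) n := by
  show 0 < a + n * List.foldr (fun a acc => a + n * acc) 0 t
  have : 0 ≤ n * evalList t n := mul_nonneg hn (evalList_nonneg_of_forall_nonneg t ht n hn)
  simpa [evalList] using add_pos_of_pos_of_nonneg ha this

/-- All twenty coefficients of `P₄` are positive (kernel check of the verbatim list). -/
theorem P4_coeffs_pos : ∀ a ∈ P 4, 0 < a := by decide

/-- **The leading coefficient never vanishes on `ℕ`:** `P₄(n) > 0` for every natural `n`. -/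
theorem evalList_P4_pos (n : ℕ) : 0 < evalList (P 4) n := by
  have h4 : P 4 = (928546861989888 : ℤ) :: (P 4).tail := by decide
  rw [h4]
  refine evalList_pos_of_forall_pos _ _ (by norm_num) ?_ _ (by positivity)
  intro b hb
  have hb' : b ∈ P 4 := by rw [h4]; exact List.mem_cons_of_mem _ hb
  exact le_of_lt (P4_coeffs_pos b hb')

/-- The recurrence solved for its last term: `P₄(n)·u(n+4) = −(P₀u(n) + P₁u(n+1) + P₂u(n+2) + P₃u(n+3))`. -/
theorem opApply_eq_zero_iff (u : ℕ → ℤ) (n : ℕ) :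
    opApply u n = 0 ↔ evalList (P 4) n * u (n + 4) =
      -(evalList (P 0) n * u n + evalList (P 1) n * u (n + 1) + evalList (P 2) n * u (n + 2) +
        evalList (P 3) n * u (n + 3)) := by
  unfold opApply
  constructor <;> intro h <;> linarith

/-- **UNIQUENESS for the VIM recurrence.**  Any integer sequence annihilated by the cell's order-4 operator and agreeing with `A` at
`n = 0,1,2,3` is `A` — by `P₄ > 0` (`evalList_P4_pos`) and the kernel theorem `VIMLeadingRecurrence` (`Certificates/VIML3Holds`). -/
theorem eq_A_of_opApply_eq_zero (u : ℕ → ℤ) (hu : ∀ n, opApply u n = 0)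
    (h0 : u 0 = 1) (h1 : u 1 = 61) (h2 : u 2 = 52921) (h3 : u 3 = 94357501) : ∀ n, u n = A n := by
  have hA : ∀ n, opApply A n = 0 := Certificates.VIMInner.L3.vimLeadingRecurrence_holds
  intro n
  induction n using Nat.strong_induction_on with
  | _ n ih =>
    match n, ih with
    | 0, _ => rw [h0, A_zero]
    | 1, _ => rw [h1, A_one]
    | 2, _ => rw [h2, A_two]
    | 3, _ => rw [h3, A_three]
    | m + 4, ih =>
      have e0 : u m = A m := ih m (by omega)
      have e1 : u (m + 1) = A (m + 1) := ih (m + 1) (by omega)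
      have e2 : u (m + 2) = A (m + 2) := ih (m + 2) (by omega)
      have e3 : u (m + 3) = A (m + 3) := ih (m + 3) (by omega)
      have hu' := (opApply_eq_zero_iff u m).1 (hu m)
      have hA' := (opApply_eq_zero_iff A m).1 (hA m)
      rw [e0, e1, e2, e3, ← hA'] at hu'
      exact mul_left_cancel₀ (ne_of_gt (evalList_P4_pos m)) hu'

/-! ## The torus period of the VIM dual cell as a three-fold chain sum -/

namespace VIMTorus

/-- Inner sum `M₁(n,u) = Σ_{i=0}^{n} C(n,i)² C(n+i,n) C(n+i,u)`. -/
def M₁ (n u : ℕ) : ℕ :=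
  ((List.range (n + 1)).map fun i => n.choose i ^ 2 * (n + i).choose n * (n + i).choose u).sum

/-- Inner sum `M₂(n,u) = Σ_{v=0}^{n} C(2n−u,v) C(n,v) C(2n−v,n)²`. -/
def M₂ (n u : ℕ) : ℕ :=
  ((List.range (n + 1)).map fun v => (2 * n - u).choose v * n.choose v * (2 * n - v).choose n ^ 2).sum

/-- **The VIM torus period** (constant term of the `n`-th power of the basic integrand on the dual cell, gauge `τ⁻¹(9)` at infinity, by
the three-split extraction — see the module docstring; here a DEFINITION):
`J(n) = Σ_{u=0}^{n} C(n,u) C(2n−u,n) M₁(n,u) M₂(n,u)`. -/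
def J (n : ℕ) : ℕ :=
  ((List.range (n + 1)).map fun u => n.choose u * (2 * n - u).choose n * M₁ n u * M₂ n u).sum

/-- `J 0 = 1` (decided). (docstring added by the filing lane, P2 g7) -/
theorem J_zero : J 0 = 1 := by decide
/-- `J 1 = 61` (decided). (docstring added by the filing lane, P2 g7) -/
theorem J_one : J 1 = 61 := by decide
/-- `J 2 = 52921` (decided). (docstring added by the filing lane, P2 g7) -/
theorem J_two : J 2 = 52921 := by decide
/-- `J 3 = 94357501` (decided). (docstring added by the filing lane, P2 g7) -/
theorem J_three : J 3 = 94357501 := by decide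
/-- `J 4 = 235634763001` (decided). (docstring added by the filing lane, P2 g7) -/
theorem J_four : J 4 = 235634763001 := by decide
/-- `J 5 = 715362962769061` (decided). (docstring added by the filing lane, P2 g7) -/
theorem J_five : J 5 = 715362962769061 := by decide

/-- **D-exact(VIM) instances on the diagonal (kernel):** the torus period equals the leading (`ζ(7)`-) coefficient `A n` for `n ≤ 5`. -/
theorem J_eq_A_upto_five : ∀ n ≤ 5, (J n : ℤ) = A n := by
  intro n hn
  interval_cases n
  · rw [J_zero, A_zero]; rfl
  · rw [J_one, A_one]; rfl
  · rw [J_two, A_two]; rfl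
  · rw [J_three, A_three]; rfl
  · rw [J_four, A_four]; rfl
  · rw [J_five, A_five]; rfl

/-- OPEN NODE (the target of ONE outer ∂-finite creative-telescoping certificate; NOT claimed): the cell's order-4 operator annihilates the
torus period.  Evidence outside the kernel: `J n = A n` for all `n ≤ 130` and `VIMLeadingRecurrence`. -/
@[conjecture] def TorusPeriodRecurrence : Prop := ∀ n : ℕ, opApply (fun k => (J k : ℤ)) n = 0

/-- The operator annihilates the torus period at `n = 0` and `n = 1` (kernel instances of the node; use `J 0 … J 5`). -/
theorem torusPeriodRecurrence_at_zero_one :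
    opApply (fun k => (J k : ℤ)) 0 = 0 ∧ opApply (fun k => (J k : ℤ)) 1 = 0 := by
  refine ⟨?_, ?_⟩
  · show evalList (P 0) 0 * (J 0 : ℤ) + evalList (P 1) 0 * (J (0 + 1) : ℤ) + evalList (P 2) 0 * (J (0 + 2) : ℤ) +
        evalList (P 3) 0 * (J (0 + 3) : ℤ) + evalList (P 4) 0 * (J (0 + 4) : ℤ) = 0
    rw [show (0:ℕ) + 1 = 1 from rfl, show (0:ℕ) + 2 = 2 from rfl, show (0:ℕ) + 3 = 3 from rfl, show (0:ℕ) + 4 = 4 from rfl,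
      J_zero, J_one, J_two, J_three, J_four]
    decide
  · show evalList (P 0) 1 * (J 1 : ℤ) + evalList (P 1) 1 * (J (1 + 1) : ℤ) + evalList (P 2) 1 * (J (1 + 2) : ℤ) +
        evalList (P 3) 1 * (J (1 + 3) : ℤ) + evalList (P 4) 1 * (J (1 + 4) : ℤ) = 0
    rw [show (1:ℕ) + 1 = 2 from rfl, show (1:ℕ) + 2 = 3 from rfl, show (1:ℕ) + 3 = 4 from rfl, show (1:ℕ) + 4 = 5 from rfl,
      J_one, J_two, J_three, J_four, J_five]
    decide

/-- **D-exact(VIM) on the whole diagonal from the recurrence node**: if the operator annihilates the torus period, then `A n = J n`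
for every `n` (uniqueness `eq_A_of_opApply_eq_zero` + the four initial values). -/
theorem dexactDiag_of_recurrence (h : TorusPeriodRecurrence) : ∀ n : ℕ, A n = (J n : ℤ) := by
  intro n
  have := eq_A_of_opApply_eq_zero (fun k => (J k : ℤ)) h
    (by rw [J_zero]; rfl) (by rw [J_one]; rfl) (by rw [J_two]; rfl) (by rw [J_three]; rfl) n
  exact this.symm

end VIMTorus

end Summit.KontsevichZagierPeriods.Zeta5Search.Families.Cellular
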